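import Mathlib
import HarnessLib
import Summits.HubbardSuperconductivity.HubbardSuperconductivity.Theorems.KLProgrammeKLRegimeEngineTowerBookkeepingProfile
import Summits.HubbardSuperconductivity.HubbardSuperconductivity.Theorems.KLProgrammeKLRegimeEngineTowerInstProfileLevRate
import Summits.HubbardSuperconductivity.HubbardSuperconductivity.Theorems.KLProgrammeKLRegimeEngineTowerInstUVLevBlockZero

/-!
# Route `KLProgramme` — crux K3 ENGINE (stmt-HubbardSuperconductivity-20437 `KLRegimeEngineV17F2`), stub (b) v2, THE LEVELS PACKAGE (ℓ):
# THE LEVELLED TOWER LAW FROM NAMED INPUTS — the kit (T3-P) instantiated at the five level tracks, with the re-measurement side DISCHARGED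
# (cell gate-hubbard-kl, seat p4 g18; memo HOME/prover-p4/F1-HMU-SQUEEZE.md §7; E1's (I7)-LEV by the substitute precedent — E1 may rename or supersede)

`towerBorn_le_law_tracks_of_profile` (…BookkeepingProfile) at `T := Fin 5` (track `t` = `t + 1` known legs), `b t k p := klTowerBLev … d t k p`,
`μ k m := klTowerMuLev … d k m`.  Of its hypotheses, this file DISCHARGES from the tree: `h0` (the born array vanishes at block `0`), `hμ0`, `hprof` (block `0`:
`klTowerMuLev_blockZero_le`; blocks `k ≥ 1`: `klTowerMuLev_le_profileR_of_levelZero` (a)) and `hprof3` for every track but the located six-leg cell — and takes AS NAMED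
INPUTS exactly what is not in the tree: the step `hstep` in the kit's literal shape at `μ := klTowerMuLev` (k3c2-p3's `…_graded_succ_units` rows + the [calc] link of KL STATUS
19:43Z), the imports `ι₁, ι₂` (E1 (I4)), the located cell `klTowerMuLevAt … d 0 k 3 ≤ X·λ²` («(I2)-F1-HMU»), and the kit's numerics (E1 (I5)) at constants `A′ ≥ max(27⁵ε_x, A′_R)`,
`Q′ ≥ max(Qe.CE/ε_x², Q′_R)`, `ι₃ ≥ max(X, A′Q′³)` (`A′_R = 27⁵(C₁/C₂)8^{d−1}(ε_x + A/(1−((√2)^d)⁻¹))`, `Q′_R = C₂²(2^{d−1})⁻¹·max Q (Qe.CE/ε_x²)`, `ε_x = imagTimeWeight β M`).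

* **`klTowerBLev_le_law_of_inputs`** — ⊢ `∀ k ≤ K_b, ∀ t, ∀ 3 ≤ p ≤ D, klTowerBLev … d t k p ≤ A λ^{p−1} Q^p`.
Composition of landed theorems; nothing about the model is asserted beyond them and the named inputs; nothing asserts (ℓ), any stub, K3 or superconductivity.
References: BGM 2006 §2.8 (2.83), (2.93)–(2.98) [cite: BenfattoGiulianiMastropietro2006].
-/

noncomputable section

namespace Summit.HubbardSuperconductivity.HubbardSuperconductivity.Theorems.EngineV8

set_option linter.dupNamespace false -- summit = problem name (single-conjunct summit), D-0017

open Classical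
open Real Finset Literature.MathematicalPhysics.QuantumLattice Literature.Probability.LatticeModels GrassmannAlgebra
open Literature.MathematicalPhysics.QuantumLattice.FermiRG
open Summit.HubbardSuperconductivity.HubbardSuperconductivity.Theorems.KLProgrammeLegKernels
open Summit.HubbardSuperconductivity.HubbardSuperconductivity.Theorems.KLRegimeSplit
open Summit.HubbardSuperconductivity.HubbardSuperconductivity.Theorems.KLRegimeWick
open Summit.HubbardSuperconductivity.HubbardSuperconductivity.Theorems.TorusFourierL2
open Summit.HubbardSuperconductivity.HubbardSuperconductivity.Theorems.DispersionFlow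
open Summit.HubbardSuperconductivity.HubbardSuperconductivity.Theorems.PerturbedFermiCurve

/-- **THE LEVELLED TOWER LAW FROM NAMED INPUTS** (see the module docstring for the dictionary and for which hypotheses are discharged / named).
[cite: BenfattoGiulianiMastropietro2006, §2.8 (2.83), (2.93)-(2.98)] -/
theorem klTowerBLev_le_law_of_inputs :
    ∃ C₁ C₂ : ℝ, 0 < C₁ ∧ 0 < C₂ ∧ ∀ R : RenConsts, R.WF2 → ∃ c₃' : ℝ, 0 < c₃' ∧ ∃ U₀' : ℝ, 0 < U₀' ∧
      ∀ (P : SplitConsts) (c : ℝ), P.WF → 0 < c → c ≤ klEngC₃6 P R → c ≤ c₃' →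
      ∀ μ ∈ klWindowC, ∀ U : ℝ, 0 < U → U ≤ klEngU₀9 P R c → U ≤ U₀' → ∀ β : ℝ, klBetaMin ≤ β → β ≤ Real.exp (c / U ^ 2) →
      ∀ K : TrigPolyC4v, FrameOK R U (nScales β) μ K → ∀ (L M : ℕ) [NeZero L] [NeZero M],
      klEngL₃ β U ≤ L → klEngM₃ β U L ≤ M → ∀ d Kb D : ℕ, 2 ≤ d → d * Kb - 1 ≤ nScales β + 1 → 3 ≤ D →
      ∀ (Qe : EngConsts), 0 ≤ Qe.CE → KernelNormsLevels L M P Qe β U μ K 0 →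
      ∀ (A lam Q : ℝ), 0 ≤ A → 0 < Q → epsCoupling P U 0 ≤ lam →
      ∀ (A' Q' : ℝ), (27 : ℝ) ^ 5 * imagTimeWeight β M ≤ A' →
        (27 : ℝ) ^ 5 * (C₁ / C₂) * (8 : ℝ) ^ (d - 1) * (imagTimeWeight β M + A / (1 - (Real.sqrt 2 ^ d)⁻¹)) ≤ A' →
        Qe.CE / imagTimeWeight β M ^ 2 ≤ Q' → C₂ ^ 2 * ((2 : ℝ) ^ (d - 1))⁻¹ * max Q (Qe.CE / imagTimeWeight β M ^ 2) ≤ Q' → 0 < Q' →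
      ∀ (σ Φ ψ τ ι₁ ι₂ ι₃ X : ℝ), 0 ≤ σ → 0 ≤ Φ → 0 ≤ ψ → 0 < τ → X ≤ ι₃ → A' * Q' ^ 3 ≤ ι₃ →
      -- the imports (E1 (I4))
      (∀ k < Kb, klTowerMuLev L M β U μ K d k 1 ≤ ι₁ * lam) → (∀ k < Kb, klTowerMuLev L M β U μ K d k 2 ≤ ι₂ * lam) →
      -- the located six-leg cell «(I2)-F1-HMU»
      (∀ k, 1 ≤ k → k < Kb → klTowerMuLevAt L M β U μ K d 0 k 3 ≤ X * lam ^ 2) →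
      -- the step (k3c2-p3's graded rows at `μ := klTowerMuLev`, E1 (I1))
      (∀ t : Fin 5, ∀ k < Kb, ∀ N : ℕ, 2 ≤ N → ∀ p, 3 ≤ p → p ≤ D → Φ * towerV D τ (klTowerMuLev L M β U μ K d k) < 1 →
        klTowerBLev L M β U μ K d t (k + 1) p ≤
          towerFO D σ (klTowerMuLev L M β U μ K d k) p +
            ∑ n ∈ Icc 2 N, exp 1 * Φ ^ (n - 1) * ψ ^ p * towerS D τ (klTowerMuLev L M β U μ K d k) n p +
            ψ ^ p * exp 1 * towerV D τ (klTowerMuLev L M β U μ K d k) * (Φ * towerV D τ (klTowerMuLev L M β U μ K d k)) ^ N /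
              (1 - Φ * towerV D τ (klTowerMuLev L M β U μ K d k))) →
      -- the kit's numerics (E1 (I5))
      4 * σ * lam * Q' < 1 → 2 * lam * τ * Q' ≤ 1 → exp 1 * τ * lam * Q' < 1 →
      Φ * (τ * (ι₁ * lam + ι₂ / (2 * Q') + ι₃ / (4 * Q' ^ 2) + A' * Q' / 4)) < 1 →
      Φ * (exp 1 * τ * (ι₁ * lam) + (exp 1 * τ) ^ 2 * (ι₂ * lam) + (exp 1 * τ) ^ 3 * (ι₃ * lam ^ 2) +
        A' * (exp 1 * τ * Q') * ((exp 1 * τ * lam * Q') ^ 3 / (1 - exp 1 * τ * lam * Q'))) < 1 →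
      4 * Q' ≤ Q → 2 * τ * ψ * Q' ≤ Q →
      A' * (4 * Q') ^ 3 * (4 * σ * lam * Q' / (1 - 4 * σ * lam * Q')) +
        exp 1 * ψ * (2 * τ * ψ * Q') ^ 2 * (τ * (ι₁ * lam + ι₂ / (2 * Q') + ι₃ / (4 * Q' ^ 2) + A' * Q' / 4)) *
          (Φ * (τ * (ι₁ * lam + ι₂ / (2 * Q') + ι₃ / (4 * Q' ^ 2) + A' * Q' / 4)) /
            (1 - Φ * (τ * (ι₁ * lam + ι₂ / (2 * Q') + ι₃ / (4 * Q' ^ 2) + A' * Q' / 4)))) ≤ A * Q ^ 3 →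
      ∀ k ≤ Kb, ∀ (t : Fin 5) (p : ℕ), 3 ≤ p → p ≤ D → klTowerBLev L M β U μ K d t k p ≤ A * lam ^ (p - 1) * Q ^ p := by
  obtain ⟨C₁, C₂, hC₁, hC₂, h⟩ := klTowerMuLev_le_profileR_of_levelZero
  refine ⟨C₁, C₂, hC₁, hC₂, fun R hR2 => ?_⟩
  obtain ⟨c₃, hc₃, U₀, hU₀, h'⟩ := h R hR2
  refine ⟨c₃, hc₃, U₀, hU₀, ?_⟩
  intro P c hP hc hc6 hc₃' μ hμ U hU hU9 hU₀' β hβmin hβc K hK L M _ _ hL3 hM3 d Kb D hd hKbN hD Qe hCE h0 A lam Q hA hQ hεl A' Q' hA'1 hA'2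
    hQ'1 hQ'2 hQ'0 σ Φ ψ τ ι₁ ι₂ ι₃ X hσ hΦ hψ hτ hXι hAQι hι₁ hι₂ hcell hstep hx₁ hx₂ hx₃ hy hθ hu₁ hu₂ hclose
  have hβ : 0 < β := KLRegimeSplit.pos_of_klBetaMin_le hβmin
  have hK1 : 1 ≤ P.Klam := hP.1
  have hε0 : 0 < epsCoupling P U 0 := by
    unfold epsCoupling
    have : 0 < |U| + U ^ 2 * (0 : ℕ) := by simp [abs_pos.2 hU.ne']
    positivity
  have hlam : 0 < lam := hε0.trans_le hεl
  have hx : 0 < imagTimeWeight β M := by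
    unfold imagTimeWeight
    have : (0 : ℝ) < M := Nat.cast_pos.2 (Nat.pos_of_ne_zero (NeZero.ne M))
    positivity
  have hA'0 : 0 ≤ A' := le_trans (by positivity) hA'1
  have hQuv0 : 0 ≤ Qe.CE / imagTimeWeight β M ^ 2 := by positivity
  -- the profile constants of the `R` rows and their domination by `A′, Q′`
  set AR : ℝ := (27 : ℝ) ^ 5 * (C₁ / C₂) * (8 : ℝ) ^ (d - 1) * (imagTimeWeight β M + A / (1 - (Real.sqrt 2 ^ d)⁻¹)) with hAR
  set QR : ℝ := C₂ ^ 2 * ((2 : ℝ) ^ (d - 1))⁻¹ * max Q (Qe.CE / imagTimeWeight β M ^ 2) with hQR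
  have hρ1 : (Real.sqrt 2 ^ d)⁻¹ < 1 := by
    have hs1 : 1 ≤ Real.sqrt 2 := Real.one_le_sqrt.2 (by norm_num)
    have h2 : Real.sqrt 2 ^ 2 = 2 := Real.sq_sqrt (by norm_num)
    have : (1 : ℝ) < Real.sqrt 2 ^ d := by
      calc (1 : ℝ) < 2 := by norm_num
        _ = Real.sqrt 2 ^ 2 := h2.symm
        _ ≤ Real.sqrt 2 ^ d := pow_le_pow_right₀ hs1 hd
    exact inv_lt_one_of_one_lt₀ this
  have hAR0 : 0 ≤ AR := by
    have : 0 ≤ A / (1 - (Real.sqrt 2 ^ d)⁻¹) := div_nonneg hA (sub_nonneg.2 hρ1.le)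
    positivity
  have hQR0 : 0 ≤ QR := by
    have : 0 ≤ max Q (Qe.CE / imagTimeWeight β M ^ 2) := le_max_of_le_left hQ.le
    positivity
  have hdom : ∀ m : ℕ, AR * lam ^ (m - 1) * QR ^ m ≤ A' * lam ^ (m - 1) * Q' ^ m := fun m =>
    mul_le_mul (mul_le_mul_of_nonneg_right hA'2 (pow_nonneg hlam.le _)) (pow_le_pow_left₀ hQR0 hQ'2 m) (pow_nonneg hQR0 _) (by positivity)
  have hdom0 : ∀ m : ℕ, (27 : ℝ) ^ 5 * imagTimeWeight β M * lam ^ (m - 1) * (Qe.CE / imagTimeWeight β M ^ 2) ^ m ≤ A' * lam ^ (m - 1) * Q' ^ m :=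
    fun m => mul_le_mul (mul_le_mul_of_nonneg_right hA'1 (pow_nonneg hlam.le _)) (pow_le_pow_left₀ hQuv0 hQ'1 m) (pow_nonneg hQuv0 _)
      (by positivity)
  -- the kit's block-wise conditions from the rows
  have hkN : ∀ k, k < Kb → d * k - 1 ≤ nScales β + 1 := fun k hk =>
    le_trans (Nat.sub_le_sub_right (Nat.mul_le_mul_left d hk.le) 1) hKbN
  refine towerBorn_le_law_tracks_of_profile (T := Fin 5) (K := Kb) (D := D) (b := fun t k p => klTowerBLev L M β U μ K d t k p)
    (μ := fun k m => klTowerMuLev L M β U μ K d k m) (A := A) (lam := lam) (Q := Q) (A' := A') (Q' := Q') (ι₃ := ι₃)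
    hlam hQ.le hσ hΦ hψ hτ hQ'0 hA'0 (fun k m => klTowerMuLev_nonneg hβ U μ K d k m) ?_ ?_ ?_ hι₁ hι₂ hstep hx₁ hx₂ hx₃ hy hθ hu₁ hu₂ hclose
  · -- `h0`: the born array vanishes at block `0`
    intro t p _ _
    rw [klTowerBLev_zero]
    positivity
  · -- `hprof`: block `0` from the level-zero package, blocks `k ≥ 1` from the `R` rows
    intro k hk ih m hm hmD
    rcases Nat.eq_zero_or_pos k with rfl | hk1
    · exact (klTowerMuLev_blockZero_le hβ hP h0 hCE hεl d (by omega)).trans (hdom0 m)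
    · have hrow := h' P c hP hc hc6 hc₃' μ hμ U hU hU9 hU₀' β hβmin hβc K hK L M hL3 hM3 d k hd hk1 (hkN k hk) D Qe hCE h0 A lam Q hA hQ.le hεl
        (fun k' _ hk'k t p hp hpD => ih k' hk'k t p hp hpD)
      exact (hrow.1 m hm hmD).trans (hdom m)
  · -- `hprof3`: the same at six legs, the `t = 0` cell taken from the named input `X`
    intro k hk hD3 ih
    rcases Nat.eq_zero_or_pos k with rfl | hk1
    · calc klTowerMuLev L M β U μ K d 0 3 ≤ (27 : ℝ) ^ 5 * imagTimeWeight β M * lam ^ (3 - 1) * (Qe.CE / imagTimeWeight β M ^ 2) ^ 3 :=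
            klTowerMuLev_blockZero_le hβ hP h0 hCE hεl d le_rfl
        _ ≤ A' * lam ^ (3 - 1) * Q' ^ 3 := hdom0 3
        _ = A' * Q' ^ 3 * lam ^ 2 := by ring
        _ ≤ ι₃ * lam ^ 2 := mul_le_mul_of_nonneg_right hAQι (sq_nonneg _)
    · have hrow := h' P c hP hc hc6 hc₃' μ hμ U hU hU9 hU₀' β hβmin hβc K hK L M hL3 hM3 d k hd hk1 (hkN k hk) D Qe hCE h0 A lam Q hA hQ.le hεl
        (fun k' _ hk'k t p hp hpD => ih k' hk'k t p hp hpD)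
      refine (hrow.2 (X * lam ^ 2) hD3 (hcell k hk1 hk)).trans (max_le ?_ ?_)
      · exact mul_le_mul_of_nonneg_right hXι (sq_nonneg _)
      · calc AR * lam ^ 2 * QR ^ 3 = AR * lam ^ (3 - 1) * QR ^ 3 := by norm_num
          _ ≤ A' * lam ^ (3 - 1) * Q' ^ 3 := hdom 3
          _ = A' * Q' ^ 3 * lam ^ 2 := by ring
          _ ≤ ι₃ * lam ^ 2 := mul_le_mul_of_nonneg_right hAQι (sq_nonneg _)

end Summit.HubbardSuperconductivity.HubbardSuperconductivity.Theorems.EngineV8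

end
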